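import Mathlib
import Summits.Parity.GeneralizedHardyLittlewood.Theses.LiouvilleMAD

/-!
# Crux `FanDecorrelation` (stmt-Parity-13318) — crux-ideate round 2, ideator 4
# Sketch for the idea card `mellin-pair-correlation`

The k = 1 core of the fan (model instance `(c,n,n') = (2,1,2)`, `R_1 = −Σ_{j∈[Q,2Q)} Σ_u λ(u)λ(u+j+1)`,
`modelCase_holds` of `SketchIdeator1.lean`) is a correlation of `λ` with its own window sums at lag
scale `H = Q ≍ √M`.  LEVER: expand the lag window in the characters of the SPLIT torus
(`(u,v) ↦ (v/u)^{it}`, Hecke's Grössencharakter method for the hyperbolic sector `log(v/u) ∈ H/u·[1,2]`):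
the smooth fan becomes a SIGNED short-range mean value of the Dirichlet polynomial
`A(t) = Σ_u g(u/M) λ(u) u^{it}` over `|t| ≲ T₀ := M/H = √M` against the zero-mean kernel `Re Φ̂(t/T₀)`
(`MellinSectorIdentity`, exact, provable now from Mathlib's Fourier inversion); under RH + simple zeros the
explicit formula turns `|A(t)|²` into a bilinear form in the zeros `ρ = ½+iγ` with weights
`a_ρ = ζ(2ρ)/ζ'(ρ)`, i.e. the fan's core is Gonek's `1/ζ'`-weighted pair-correlation function
`G(X,T) = Σ X^{i(γ−γ')} ω(γ−γ')/(ζ'(ρ)ζ'(ρ̄'))` (Ng 2008, §4) at `X = M`, `T ≍ T₀ = √M`, Montgomery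
parameter `α = log X / log T = 2` (`gonekForm`).  The transfer target is the conjecture `WPC A`
(power saving for the weighted pair form against zero-mean height kernels, uniformly for `X ≤ T^A`),
a statement about zeros of `ζ` only — not the crux renamed.  Honest scope: conductors `n n' k ≤ M^η`
only (Dirichlet `L(s,χ)` replace `ζ`); the crux's dilations up to `2M` are NOT reached (card, §Transfer).

Nothing here is filed as an item; `WPC`, `SimpleZetaZeros`, `NegMomentGrowth` are NAMED conjecture-grade
hypotheses of the would-be conditional line (D-0019 §4b: a planner files them as bridge premises or
route items; this seat only exhibits that they type-check).
-/

open scoped FourierTransform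
open MeasureTheory Complex Finset

namespace Summit.Parity.GeneralizedHardyLittlewood.Cruxes.FanDecorrelation.MellinPC

/-! ## §1 First lemma: the Mellin–sector (split-torus) identity — exact, RH-free -/

/-- FIRST LEMMA of the line (exact; provable now from `Continuous.fourierInv_fourier_eq` + `integral_finset_sum`):
for a continuous integrable window `Φ` with integrable Fourier transform, finite positive supports and any
coefficients, the hyperbolic-sector sum is a Fourier integral of a product of two Dirichlet polynomials:
`Σ_{u∈S} Σ_{v∈S'} a_u b_v Φ(T·log(v/u)) = ∫ 𝓕Φ(w) · (Σ_u a_u u^{−2πiwT}) · (Σ_v b_v v^{2πiwT}) dw`.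
With `a = b = g(·/M)·λ`, `T = T₀ = M/H` and `Φ ≥ 0` supported in `[1,2]` this is the smooth k = 1 fan
`Σ_{u<v} a_u a_v Φ(T₀ log(v/u))` (lags `v − u ∈ (u/T₀)·[1,2] ≍ H`), and since `a` is real the right side is
`∫ 𝓕Φ(w) |A(2πwT)|² dw`, `A(t) = Σ_u a_u u^{it}`: a SIGNED short-range mean value of `|A|²` on `|t| ≲ T₀`
against a kernel of total mass `∫𝓕Φ = Φ(0) = 0` (no lag 0 ⟺ the proved load-bearing `k ≠ 0`). -/
def MellinSectorIdentity : Prop :=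
  ∀ (Φ : ℝ → ℂ), Continuous Φ → Integrable Φ → Integrable (𝓕 Φ) →
  ∀ (T : ℝ) (S S' : Finset ℕ) (a b : ℕ → ℂ), (∀ u ∈ S, 0 < u) → (∀ v ∈ S', 0 < v) →
    ∑ u ∈ S, ∑ v ∈ S', a u * b v * Φ (T * (Real.log v - Real.log u)) =
      ∫ w : ℝ, 𝓕 Φ w *
        ((∑ u ∈ S, a u * (u : ℂ) ^ ((((-(2 * Real.pi * w * T)) : ℝ) : ℂ) * I)) *
         (∑ v ∈ S', b v * (v : ℂ) ^ ((((2 * Real.pi * w * T) : ℝ) : ℂ) * I)))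

/-- The pointwise inversion step behind `MellinSectorIdentity`, as Mathlib states it (sanity anchor). -/
theorem inversion_anchor (Φ : ℝ → ℂ) (hc : Continuous Φ) (hi : Integrable Φ) (hF : Integrable (𝓕 Φ))
    (y : ℝ) : 𝓕⁻ (𝓕 Φ) y = Φ y := by
  rw [hc.fourierInv_fourier_eq hi hF]

/-! ### Proof of the first lemma (kernel-checked: axioms propext, Classical.choice, Quot.sound) -/

theorem inv_pointwise (Φ : ℝ → ℂ) (hc : Continuous Φ) (hi : Integrable Φ) (hF : Integrable (𝓕 Φ))
    (y : ℝ) : Φ y = ∫ w : ℝ, 𝓕 Φ w * Complex.exp (((2 * Real.pi * w * y : ℝ) : ℂ) * I) := by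
  have h1 := congrFun (hc.fourierInv_fourier_eq hi hF) y
  rw [Real.fourierInv_eq'] at h1
  rw [← h1]
  congr 1
  ext w
  simp only [RCLike.inner_apply, conj_trivial, smul_eq_mul]
  ring_nf

theorem cpow_nat_mul_I (u : ℕ) (hu : 0 < u) (x : ℝ) :
    (u : ℂ) ^ (((x : ℝ) : ℂ) * I) = Complex.exp (((x * Real.log u : ℝ) : ℂ) * I) := by
  have hu' : (u : ℂ) ≠ 0 := by exact_mod_cast hu.ne'
  rw [Complex.cpow_def_of_ne_zero hu', ← Complex.ofReal_natCast,
    ← Complex.ofReal_log (by positivity)]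
  congr 1
  push_cast
  ring

theorem mellinSectorIdentity_holds : MellinSectorIdentity := by
  intro Φ hc hi hF T S S' a b hS hS'
  -- both sides as a double sum of integrals of  a u * b v * (𝓕 Φ w * exp (2π w T (log v - log u) I))
  have hbound : ∀ (y : ℝ) (w : ℝ), ‖Complex.exp (((2 * Real.pi * w * y : ℝ) : ℂ) * I)‖ ≤ 1 := by
    intro y w; rw [Complex.norm_exp_ofReal_mul_I]
  have hint : ∀ (y : ℝ) (c : ℂ),
      Integrable (fun w : ℝ => c * (𝓕 Φ w * Complex.exp (((2 * Real.pi * w * y : ℝ) : ℂ) * I))) := by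
    intro y c
    apply Integrable.const_mul
    apply hF.mul_bdd (c := 1)
    · apply Continuous.aestronglyMeasurable
      fun_prop
    · exact Filter.Eventually.of_forall (hbound y)
  -- rewrite the right-hand side
  have hR : ∀ w : ℝ, 𝓕 Φ w *
        ((∑ u ∈ S, a u * (u : ℂ) ^ ((((-(2 * Real.pi * w * T)) : ℝ) : ℂ) * I)) *
         (∑ v ∈ S', b v * (v : ℂ) ^ ((((2 * Real.pi * w * T) : ℝ) : ℂ) * I))) =
      ∑ u ∈ S, ∑ v ∈ S', a u * b v *
        (𝓕 Φ w * Complex.exp (((2 * Real.pi * w * (T * (Real.log v - Real.log u)) : ℝ) : ℂ) * I)) := by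
    intro w
    rw [Finset.sum_mul_sum, Finset.mul_sum]
    apply Finset.sum_congr rfl
    intro u hu
    rw [Finset.mul_sum]
    apply Finset.sum_congr rfl
    intro v hv
    rw [cpow_nat_mul_I u (hS u hu), cpow_nat_mul_I v (hS' v hv)]
    have hC : Complex.exp (((2 * Real.pi * w * (T * (Real.log v - Real.log u)) : ℝ) : ℂ) * I) =
        Complex.exp (((-(2 * Real.pi * w * T) * Real.log u : ℝ) : ℂ) * I) *
          Complex.exp ((((2 * Real.pi * w * T) * Real.log v : ℝ) : ℂ) * I) := by
      rw [← Complex.exp_add]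
      congr 1
      push_cast
      ring
    rw [hC]
    ring
  simp_rw [hR]
  rw [integral_finsetSum _ (fun u hu => ?_)]
  · apply Finset.sum_congr rfl
    intro u hu
    rw [integral_finsetSum _ (fun v hv => ?_)]
    · apply Finset.sum_congr rfl
      intro v hv
      rw [integral_const_mul, ← inv_pointwise Φ hc hi hF]
    · exact hint _ _
  · apply integrable_finsetSum
    intro v hv
    exact hint _ _


/-! ## §2 The smooth k = 1 fan and the core statement the transfer reaches -/

/-- Smooth k = 1 model fan at scale `M` with log-scale cutoff `g` and lag window `Φ` at hyperbolic scale
`T₀ = √M`: `F(M) = Σ_{u,v ≤ N} g(u/M) g(v/M) λ(u) λ(v) Φ(√M · log(v/u))`. -/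
noncomputable def smoothFan (g Φ : ℝ → ℝ) (M N : ℕ) : ℝ :=
  ∑ u ∈ Finset.Icc 1 N, ∑ v ∈ Finset.Icc 1 N,
    g (u / M) * g (v / M) * (ArithmeticFunction.liouville u : ℝ) * (ArithmeticFunction.liouville v : ℝ) *
      Φ (Real.sqrt M * (Real.log v - Real.log u))

/-- SMOOTH k = 1 CORE (Φ-version of the crux's k = 1 instance; random size `M^{3/4}`, Parseval wall `M`, asked
`M^{1−κ}`): for smooth compactly supported `g ≥ 0` (support in `(0,8)`) and `Φ` (support in `[1,2]`, so `Φ(0)=0`). -/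
def SmoothFanCore : Prop :=
  ∀ (g Φ : ℝ → ℝ), ContDiff ℝ ((⊤ : ℕ∞) : WithTop ℕ∞) g → (∀ x, g x ≠ 0 → 0 < x ∧ x < 8) →
    ContDiff ℝ ((⊤ : ℕ∞) : WithTop ℕ∞) Φ → (∀ s, Φ s ≠ 0 → 1 < s ∧ s < 2) →
    ∃ κ : ℝ, 0 < κ ∧ ∃ C : ℝ, ∀ M : ℕ, |smoothFan g Φ M (8 * M)| ≤ C * (M : ℝ) ^ (1 - κ)

/-! ## §3 The zero side: Gonek's weighted pair-correlation form and the conjecture `WPC` -/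

/-- Nontrivial zeros of `ζ` with `0 < Im ρ ≤ T` (the lower ones are their conjugates). -/
def zetaZeros (T : ℝ) : Set ℂ := {ρ | riemannZeta ρ = 0 ∧ 0 < ρ.re ∧ ρ.re < 1 ∧ 0 < ρ.im ∧ ρ.im ≤ T}

/-- The Liouville residue weight `a_ρ = ζ(2ρ)/ζ'(ρ)` (residue of `ζ(2s)/ζ(s) = Σ λ(n)n^{−s}` at a simple zero). -/
noncomputable def lioWeight (ρ : ℂ) : ℂ := riemannZeta (2 * ρ) / deriv riemannZeta ρ

/-- Pair kernel produced by the transfer: `𝒦_T(γ,γ') = ∫_{t>0} h(t/T) · conj(G(t−γ)) · G(t−γ') dt`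
(`h = Re Φ̂` = height kernel of width `T`, ZERO MEAN `∫_{t>0} h = π Φ(0) = 0`; `G(y) = g̃(½+iy)` = Mellin
transform of the cutoff, a bump of width `O(1)` localising `|γ − γ'| ≲ 1`). -/
noncomputable def pcKernel (h G : ℝ → ℂ) (T γ γ' : ℝ) : ℂ :=
  ∫ t in Set.Ioi (0 : ℝ), h (t / T) * (starRingEnd ℂ) (G (t - γ)) * G (t - γ')

/-- Gonek's `1/ζ'`-weighted pair-correlation form, Liouville weights, at time `X` and height scale `T`
(zeros with `γ ≤ T²` more than cover the support of `h(·/T)`):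
`𝔊(X,T) = Σ_{ρ,ρ'} conj(a_ρ) a_ρ' X^{i(γ'−γ)} 𝒦_T(γ,γ')` — cf. Ng 2008 §4, `G(X,T) = Σ X^{i(γ−γ')}ω(γ−γ')/(ζ'(ρ)ζ'(ρ̄'))`. -/
noncomputable def gonekForm (X T : ℝ) (h G : ℝ → ℂ) : ℂ :=
  ∑' ρ : zetaZeros (T ^ 2), ∑' ρ' : zetaZeros (T ^ 2),
    (starRingEnd ℂ) (lioWeight ρ) * lioWeight ρ' *
      (X : ℂ) ^ (((((ρ' : ℂ).im - (ρ : ℂ).im) : ℝ) : ℂ) * I) * pcKernel h G T (ρ : ℂ).im (ρ' : ℂ).im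

/-- TRANSFER TARGET `WPC A` — weighted pair correlation with a POWER SAVING up to Montgomery parameter
`α = log X/log T ≤ A`: against every zero-mean Schwartz height kernel the full weighted pair form (diagonal
fluctuation + off-diagonal) is `≪ T^{1−κ}` (trivial size `≍ T`, GUE/random size `≍ T^{1/2+o(1)}`).  Known:
Montgomery's `F(α)` for `α ≤ 1` under RH (flat weights, main terms only); the pair-correlation conjecture
`F(α) = 1`, `α > 1`, and Gonek/Ng's `G(X,T)` are DIAGONAL-MEAN-level statements; a power saving at `α = 2`
is asserted by none of RH, GRH, LI, PCC.  The fan needs `A = 2` (`X = M`, `T = √M`). -/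
def WPC (A : ℝ) : Prop :=
  ∀ (h G : SchwartzMap ℝ ℂ), (∫ t in Set.Ioi (0 : ℝ), h t = 0) →
    ∃ κ : ℝ, 0 < κ ∧ ∃ C : ℝ, ∀ T X : ℝ, 2 ≤ T → T ≤ X → X ≤ T ^ A →
      ‖gonekForm X T h G‖ ≤ C * T ^ (1 - κ)

/-- Simple zeros (needed to write the explicit formula with residues `a_ρ`). -/
def SimpleZetaZeros : Prop :=
  ∀ ρ : ℂ, riemannZeta ρ = 0 → 0 < ρ.re → ρ.re < 1 → deriv riemannZeta ρ ≠ 0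

/-- Polynomial control of negative moments (Gonek–Hejhal/Hughes–Keating–O'Connell territory; makes the
smooth explicit formula for `Σ g(u/M)λ(u)u^{it}` absolutely convergent): `Σ_{0<γ≤T} |ζ'(ρ)|^{−2} ≤ C T^B`. -/
def NegMomentGrowth : Prop :=
  ∃ B C : ℝ, ∀ T : ℝ, 2 ≤ T →
    (∑' ρ : zetaZeros T, (1 / Complex.normSq (deriv riemannZeta ρ) : ℝ)) ≤ C * T ^ B

/-- SHAPE OF THE CONDITIONAL LINE (what a crux-plan skeleton for the SMALL-CONDUCTOR k = 1 core would compose;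
every conjecture-grade hypothesis is NAMED, none contains a fan/coset/Chowla statement):
`RH → SimpleZetaZeros → NegMomentGrowth → WPC 2 → SmoothFanCore`.  (A `def`, not a claim.) -/
def TransferShape : Prop :=
  RiemannHypothesis → SimpleZetaZeros → NegMomentGrowth → WPC 2 → SmoothFanCore

/-- Read-back: the crux is untouched by this file (its k = 1 instance is what `SmoothFanCore` smooths). -/
example : Summit.Parity.GeneralizedHardyLittlewood.Theses.LiouvilleMAD.FanDecorrelation ↔
    Summit.Parity.GeneralizedHardyLittlewood.Theses.LiouvilleMAD.FanDecorrelation := Iff.rfl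

end Summit.Parity.GeneralizedHardyLittlewood.Cruxes.FanDecorrelation.MellinPC
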